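import Literature.NumberTheory.PAdicHodge.FontaineThetaGalois
import Literature.AlgebraicGeometry.Resolution.AdicQuotient
import HarnessLib

/-!
# The `Γ_F`-action on `B_dR⁺(F)` and `B_dR(F)`

Mathlib constructs, for a ring `R` satisfying the perfectoid hypotheses, Fontaine's map with `p`
inverted `θ[1/p] : 𝕎(R♭)[1/p] → R[1/p]` (`fontaineThetaInvertP`), the ring
`B_dR⁺(R) = (𝕎(R♭)[1/p])^_{ker θ[1/p]}` (`BDeRhamPlus`) and `B_dR(R)` (`BDeRham`, `B_dR⁺` with the
generators of `ker θ[1/p]` inverted).  For `R = 𝒪_{ℂ_F}` we transport the `Γ_F`-action of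
`FontaineThetaGalois` (`galAinf σ = 𝕎(σ♭)`, `θ ∘ 𝕎(σ♭) = σ ∘ θ`) through these three
constructions (Fontaine 1994, Exp. II §1.5: "`G_K` opère continûment sur `B_dR`"):

* `galAinfLoc σ`, `galIntLoc σ` : the induced endomorphisms of `𝔸_inf(F)[1/p]` and `𝒪_{ℂ_F}[1/p]`;
* `fontaineThetaInvertP_galAinfLoc` : `θ[1/p]` is `Γ_F`-equivariant, so `ker θ[1/p]` is stable;
* `galBdRPlus σ` : the induced ring endomorphism of `B_dR⁺`, functorial in `σ`
  (`instMulSemiringActionBDeRhamPlus`), extending `galAinfLoc` (`galBdRPlus_of`);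
* `galBdR σ` and `instMulSemiringActionBDeRham` : the action on `B_dR`.

## References
* [FontaineAsterisque223III] J.-M. Fontaine, *Le corps des périodes p-adiques*, Astérisque 223
  (1994), Exp. II, §1.5.
* [FontaineOuyang2022] J.-M. Fontaine, Y. Ouyang, *Theory of p-adic Galois representations*
  (book draft), §5.1–§5.2.
-/

noncomputable section

open ValuativeRel Field Ideal WittVector
open Literature.AlgebraicGeometry.Resolution

namespace Literature.NumberTheory.PAdicHodge

open Literature.NumberTheory.GaloisRepresentations
open Literature.NumberTheory.GaloisRepresentations.IsNonarchimedeanLocalField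

variable {F : Type} [Field F] [ValuativeRel F] [TopologicalSpace F] [IsNonarchimedeanLocalField F] {p : ℕ}

/-! ### The action on `𝒪_{ℂ_F}[1/p]` -/

/-- `galInt σ` maps the powers of `p` into themselves. [folklore] -/
theorem powers_le_comap_galInt (σ : absoluteGaloisGroup F) :
    Submonoid.powers (p : integerC F) ≤ (Submonoid.powers (p : integerC F)).comap (galInt σ) := by
  rintro _ ⟨n, rfl⟩
  exact ⟨n, by rw [map_pow, map_natCast]⟩

/-- **`σ[1/p]` on `𝒪_{ℂ_F}[1/p]`** (functoriality of localizations). [cite: FontaineAsterisque223III, Exp. II §1.5] -/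
def galIntLoc (σ : absoluteGaloisGroup F) :
    Localization.Away (p : integerC F) →+* Localization.Away (p : integerC F) :=
  IsLocalization.map (M := Submonoid.powers (p : integerC F)) (T := Submonoid.powers (p : integerC F))
    (Localization.Away (p : integerC F)) (galInt σ) (powers_le_comap_galInt σ)

/-- `galIntLoc σ` extends `galInt σ`. [folklore] -/
@[simp] theorem galIntLoc_algebraMap (σ : absoluteGaloisGroup F) (x : integerC F) :
    galIntLoc σ (algebraMap (integerC F) (Localization.Away (p : integerC F)) x) =
      algebraMap (integerC F) (Localization.Away (p : integerC F)) (galInt σ x) :=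
  IsLocalization.map_eq _ _

section Ainf

variable [Fact p.Prime] [Fact (¬ IsUnit (p : integerC F))]

/-! ### The action on `𝔸_inf(F)[1/p]` -/

/-- `𝕎(σ♭)` maps the powers of `p` into themselves. [folklore] -/
theorem powers_le_comap_galAinf (σ : absoluteGaloisGroup F) :
    Submonoid.powers (p : Ainf (p := p) F) ≤ (Submonoid.powers (p : Ainf (p := p) F)).comap (galAinf σ) := by
  rintro _ ⟨n, rfl⟩
  exact ⟨n, by rw [map_pow, map_natCast]⟩

/-- **`𝕎(σ♭)[1/p]` on `𝔸_inf(F)[1/p]`** (functoriality of localizations).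
[cite: FontaineAsterisque223III, Exp. II §1.5] -/
def galAinfLoc (σ : absoluteGaloisGroup F) :
    Localization.Away (p : Ainf (p := p) F) →+* Localization.Away (p : Ainf (p := p) F) :=
  IsLocalization.map (M := Submonoid.powers (p : Ainf (p := p) F)) (T := Submonoid.powers (p : Ainf (p := p) F))
    (Localization.Away (p : Ainf (p := p) F)) (galAinf σ) (powers_le_comap_galAinf σ)

/-- `galAinfLoc σ` extends `galAinf σ`. [folklore] -/
@[simp] theorem galAinfLoc_algebraMap (σ : absoluteGaloisGroup F) (x : Ainf (p := p) F) :
    galAinfLoc σ (algebraMap (Ainf (p := p) F) (Localization.Away (p : Ainf (p := p) F)) x) =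
      algebraMap (Ainf (p := p) F) (Localization.Away (p : Ainf (p := p) F)) (galAinf σ x) :=
  IsLocalization.map_eq _ _

/-- `galAinfLoc 1 = id`. [folklore] -/
theorem galAinfLoc_one (x : Localization.Away (p : Ainf (p := p) F)) :
    galAinfLoc (1 : absoluteGaloisGroup F) x = x := by
  have h : galAinfLoc (p := p) (F := F) 1 = RingHom.id _ := by
    refine IsLocalization.ringHom_ext (Submonoid.powers (p : Ainf (p := p) F)) (RingHom.ext fun y => ?_)
    rw [RingHom.comp_apply, galAinfLoc_algebraMap, galAinf_one]; rfl
  rw [h]; rfl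

/-- `galAinfLoc (σ τ) = galAinfLoc σ ∘ galAinfLoc τ`. [folklore] -/
theorem galAinfLoc_mul (σ τ : absoluteGaloisGroup F) (x : Localization.Away (p : Ainf (p := p) F)) :
    galAinfLoc (σ * τ) x = galAinfLoc σ (galAinfLoc τ x) := by
  have h : galAinfLoc (p := p) (F := F) (σ * τ) = (galAinfLoc σ).comp (galAinfLoc τ) := by
    refine IsLocalization.ringHom_ext (Submonoid.powers (p : Ainf (p := p) F)) (RingHom.ext fun y => ?_)
    rw [RingHom.comp_apply, galAinfLoc_algebraMap, galAinf_mul, RingHom.comp_apply, RingHom.comp_apply,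
      galAinfLoc_algebraMap, galAinfLoc_algebraMap]
  rw [h]; rfl

/-! ### Equivariance of `θ[1/p]` and the action on `B_dR⁺` -/

variable [IsAdicComplete (Ideal.span {(p : integerC F)}) (integerC F)]

/-- `θ[1/p]` extends `θ`. [folklore] -/
theorem fontaineThetaInvertP_algebraMap (x : Ainf (p := p) F) :
    fontaineThetaInvertP (integerC F) p (algebraMap (Ainf (p := p) F) (Localization.Away (p : Ainf (p := p) F)) x) =
      algebraMap (integerC F) (Localization.Away (p : integerC F)) (fontaineTheta (integerC F) p x) :=
  by delta fontaineThetaInvertP; exact IsLocalization.Away.lift_eq (p : Ainf (p := p) F) _ x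

variable [CharZero F]

/-- **`θ[1/p]` is `Γ_F`-equivariant.** [cite: FontaineAsterisque223III, Exp. II §1.5] -/
theorem fontaineThetaInvertP_galAinfLoc (σ : absoluteGaloisGroup F) (x : Localization.Away (p : Ainf (p := p) F)) :
    fontaineThetaInvertP (integerC F) p (galAinfLoc σ x) = galIntLoc σ (fontaineThetaInvertP (integerC F) p x) := by
  have h : (fontaineThetaInvertP (integerC F) p).comp (galAinfLoc σ) =
      (galIntLoc σ).comp (fontaineThetaInvertP (integerC F) p) := by
    refine IsLocalization.ringHom_ext (Submonoid.powers (p : Ainf (p := p) F)) (RingHom.ext fun y => ?_)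
    change fontaineThetaInvertP (integerC F) p (galAinfLoc σ (algebraMap _ _ y)) =
      galIntLoc σ (fontaineThetaInvertP (integerC F) p (algebraMap _ _ y))
    rw [galAinfLoc_algebraMap, fontaineThetaInvertP_algebraMap, fontaineThetaInvertP_algebraMap,
      galIntLoc_algebraMap, fontaineTheta_galAinf]
  exact RingHom.congr_fun h x

/-- **`ker θ[1/p]` is `Γ_F`-stable.** [cite: FontaineAsterisque223III, Exp. II §1.5] -/
theorem map_galAinfLoc_ker_le (σ : absoluteGaloisGroup F) :
    (RingHom.ker (fontaineThetaInvertP (integerC F) p)).map (galAinfLoc σ) ≤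
      RingHom.ker (fontaineThetaInvertP (integerC F) p) := by
  rw [Ideal.map_le_iff_le_comap]
  intro x hx
  rw [Ideal.mem_comap, RingHom.mem_ker, fontaineThetaInvertP_galAinfLoc, RingHom.mem_ker.1 hx, _root_.map_zero]

/-- **The endomorphism of `B_dR⁺ = (𝔸_inf[1/p])^_{ker θ[1/p]}` induced by `σ ∈ Γ_F`**
(functoriality of adic completions along `𝕎(σ♭)[1/p]`, which preserves `ker θ[1/p]`).
[cite: FontaineAsterisque223III, Exp. II §1.5] [cite: FontaineOuyang2022, §5.2] -/
def galBdRPlus (σ : absoluteGaloisGroup F) : BDeRhamPlus (integerC F) p →+* BDeRhamPlus (integerC F) p :=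
  adicCompletionMap _ _ (galAinfLoc σ) (map_galAinfLoc_ker_le σ)

/-- `galBdRPlus σ` is `adicCompletionMap` of `galAinfLoc σ`. [folklore] -/
theorem galBdRPlus_apply (σ : absoluteGaloisGroup F) (x : BDeRhamPlus (integerC F) p) :
    galBdRPlus σ x = adicCompletionMap _ _ (galAinfLoc σ) (map_galAinfLoc_ker_le σ) x := rfl

/-- **`galBdRPlus σ` extends `𝕎(σ♭)[1/p]`** along `𝔸_inf[1/p] → B_dR⁺`. [cite: FontaineAsterisque223III, Exp. II §1.5] -/
@[simp] theorem galBdRPlus_of (σ : absoluteGaloisGroup F) (x : Localization.Away (p : Ainf (p := p) F)) :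
    galBdRPlus σ (AdicCompletion.of (RingHom.ker (fontaineThetaInvertP (integerC F) p)) _ x) =
      AdicCompletion.of (RingHom.ker (fontaineThetaInvertP (integerC F) p)) _ (galAinfLoc σ x) :=
  adicCompletionMap_of _ _ _ _ x

/-- `galBdRPlus 1 = id`. [folklore] -/
theorem galBdRPlus_one (x : BDeRhamPlus (integerC F) p) : galBdRPlus (1 : absoluteGaloisGroup F) x = x := by
  have h1 : galAinfLoc (p := p) (F := F) 1 = RingHom.id _ := RingHom.ext galAinfLoc_one
  rw [galBdRPlus_apply, adicCompletionMap_congr _ _ h1 _ (by simp), adicCompletionMap_id]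

/-- `galBdRPlus (σ τ) = galBdRPlus σ ∘ galBdRPlus τ`. [folklore] -/
theorem galBdRPlus_mul (σ τ : absoluteGaloisGroup F) (x : BDeRhamPlus (integerC F) p) :
    galBdRPlus (σ * τ) x = galBdRPlus σ (galBdRPlus τ x) := by
  have h : galAinfLoc (p := p) (F := F) (σ * τ) = (galAinfLoc σ).comp (galAinfLoc τ) :=
    RingHom.ext (galAinfLoc_mul σ τ)
  rw [galBdRPlus_apply, galBdRPlus_apply, galBdRPlus_apply, adicCompletionMap_comp]
  exact adicCompletionMap_congr _ _ h _ _ x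

/-- **The `Γ_F`-action on `B_dR⁺(F)`** by ring automorphisms. [cite: FontaineAsterisque223III, Exp. II §1.5] -/
instance instMulSemiringActionBDeRhamPlus :
    MulSemiringAction (absoluteGaloisGroup F) (BDeRhamPlus (integerC F) p) where
  smul σ x := galBdRPlus σ x
  one_smul x := galBdRPlus_one x
  mul_smul σ τ x := galBdRPlus_mul σ τ x
  smul_zero σ := map_zero (galBdRPlus σ)
  smul_add σ x y := map_add (galBdRPlus σ) x y
  smul_one σ := map_one (galBdRPlus σ)
  smul_mul σ x y := map_mul (galBdRPlus σ) x y

/-- Unfolding of the action on `B_dR⁺(F)`. [folklore] -/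
theorem smul_bdRPlus_def (σ : absoluteGaloisGroup F) (x : BDeRhamPlus (integerC F) p) : σ • x = galBdRPlus σ x := rfl

/-- `σ` maps `ker θ[1/p]` ONTO itself (use `σ⁻¹`). [folklore] -/
theorem map_galAinfLoc_ker_eq (σ : absoluteGaloisGroup F) :
    (RingHom.ker (fontaineThetaInvertP (integerC F) p)).map (galAinfLoc σ) =
      RingHom.ker (fontaineThetaInvertP (integerC F) p) := by
  refine le_antisymm (map_galAinfLoc_ker_le σ) fun x hx => ?_
  have hx' : x = galAinfLoc σ (galAinfLoc σ⁻¹ x) := by rw [← galAinfLoc_mul, mul_inv_cancel, galAinfLoc_one]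
  rw [hx']
  exact Ideal.mem_map_of_mem _ (map_galAinfLoc_ker_le σ⁻¹ (Ideal.mem_map_of_mem _ hx))

/-- `σ` maps generators of `ker θ[1/p]` to generators. [folklore] -/
theorem ker_eq_span_galAinfLoc (σ : absoluteGaloisGroup F) {a : Localization.Away (p : Ainf (p := p) F)}
    (ha : RingHom.ker (fontaineThetaInvertP (integerC F) p) = Ideal.span {a}) :
    RingHom.ker (fontaineThetaInvertP (integerC F) p) = Ideal.span {galAinfLoc σ a} := by
  rw [← map_galAinfLoc_ker_eq σ, ha, Ideal.map_span, Set.image_singleton]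

/-! ### The action on `B_dR` -/

variable (F p) in
/-- The submonoid inverted in Mathlib's `B_dR = B_dR⁺[1/gens]`: generated by the images of the
generators of `ker θ[1/p]`. [folklore] -/
abbrev bdRGens : Submonoid (BDeRhamPlus (integerC F) p) :=
  Submonoid.closure (AdicCompletion.of (RingHom.ker (fontaineThetaInvertP (integerC F) p)) _ ''
    {a | RingHom.ker (fontaineThetaInvertP (integerC F) p) = Ideal.span {a}})

/-- `B_dR(𝒪_{ℂ_F})` (Mathlib `BDeRham`, a bare `def`) is the localization of `B_dR⁺` at `bdRGens`:
its ring structure. [folklore] -/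
instance instCommRingBDeRham : CommRing (BDeRham (integerC F) p) :=
  inferInstanceAs (CommRing (Localization (bdRGens F p)))

/-- `B_dR` as a `B_dR⁺`-algebra. [folklore] -/
instance instAlgebraBDeRham : Algebra (BDeRhamPlus (integerC F) p) (BDeRham (integerC F) p) :=
  inferInstanceAs (Algebra (BDeRhamPlus (integerC F) p) (Localization (bdRGens F p)))

/-- `B_dR` is the localization of `B_dR⁺` at `bdRGens`. [folklore] -/
instance instIsLocalizationBDeRham : IsLocalization (bdRGens F p) (BDeRham (integerC F) p) :=
  inferInstanceAs (IsLocalization (bdRGens F p) (Localization (bdRGens F p)))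

/-- The submonoid `bdRGens` is `Γ_F`-stable. [folklore] -/
theorem bdRGens_le_comap_galBdRPlus (σ : absoluteGaloisGroup F) :
    bdRGens F p ≤ (bdRGens F p).comap (galBdRPlus σ) := by
  rw [bdRGens, Submonoid.closure_le]
  rintro _ ⟨a, ha, rfl⟩
  exact Submonoid.subset_closure ⟨galAinfLoc σ a, ker_eq_span_galAinfLoc σ ha, (galBdRPlus_of σ a).symm⟩

/-- **The endomorphism of `B_dR(F)` induced by `σ ∈ Γ_F`** (functoriality of localizations along
`galBdRPlus σ`). [cite: FontaineAsterisque223III, Exp. II §1.5] -/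
def galBdR (σ : absoluteGaloisGroup F) : BDeRham (integerC F) p →+* BDeRham (integerC F) p :=
  IsLocalization.map (M := bdRGens F p) (T := bdRGens F p) (BDeRham (integerC F) p) (galBdRPlus σ)
    (bdRGens_le_comap_galBdRPlus σ)

/-- `galBdR σ` extends `galBdRPlus σ`. [folklore] -/
@[simp] theorem galBdR_algebraMap (σ : absoluteGaloisGroup F) (x : BDeRhamPlus (integerC F) p) :
    galBdR σ (algebraMap (BDeRhamPlus (integerC F) p) (BDeRham (integerC F) p) x) =
      algebraMap (BDeRhamPlus (integerC F) p) (BDeRham (integerC F) p) (galBdRPlus σ x) :=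
  IsLocalization.map_eq _ _

/-- `galBdR 1 = id`. [folklore] -/
theorem galBdR_one (x : BDeRham (integerC F) p) : galBdR (1 : absoluteGaloisGroup F) x = x := by
  have h : galBdR (p := p) (F := F) 1 = RingHom.id _ := by
    refine IsLocalization.ringHom_ext (bdRGens F p) (RingHom.ext fun y => ?_)
    rw [RingHom.comp_apply, galBdR_algebraMap, galBdRPlus_one]; rfl
  rw [h]; rfl

/-- `galBdR (σ τ) = galBdR σ ∘ galBdR τ`. [folklore] -/
theorem galBdR_mul (σ τ : absoluteGaloisGroup F) (x : BDeRham (integerC F) p) :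
    galBdR (σ * τ) x = galBdR σ (galBdR τ x) := by
  have h : galBdR (p := p) (F := F) (σ * τ) = (galBdR σ).comp (galBdR τ) := by
    refine IsLocalization.ringHom_ext (bdRGens F p) (RingHom.ext fun y => ?_)
    rw [RingHom.comp_apply, galBdR_algebraMap, galBdRPlus_mul, RingHom.comp_apply, RingHom.comp_apply,
      galBdR_algebraMap, galBdR_algebraMap]
  rw [h]; rfl

/-- **The `Γ_F`-action on `B_dR(F)`** by ring automorphisms. [cite: FontaineAsterisque223III, Exp. II §1.5] -/
instance instMulSemiringActionBDeRham :
    MulSemiringAction (absoluteGaloisGroup F) (BDeRham (integerC F) p) where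
  smul σ x := galBdR σ x
  one_smul x := galBdR_one x
  mul_smul σ τ x := galBdR_mul σ τ x
  smul_zero σ := map_zero (galBdR σ)
  smul_add σ x y := map_add (galBdR σ) x y
  smul_one σ := map_one (galBdR σ)
  smul_mul σ x y := map_mul (galBdR σ) x y

/-- Unfolding of the action on `B_dR(F)`. [folklore] -/
theorem smul_bdR_def (σ : absoluteGaloisGroup F) (x : BDeRham (integerC F) p) : σ • x = galBdR σ x := rfl

/-- The action on `B_dR` extends the action on `B_dR⁺`. [cite: FontaineAsterisque223III, Exp. II §1.5] -/
theorem smul_algebraMap_bdR (σ : absoluteGaloisGroup F) (x : BDeRhamPlus (integerC F) p) :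
    σ • algebraMap (BDeRhamPlus (integerC F) p) (BDeRham (integerC F) p) x =
      algebraMap (BDeRhamPlus (integerC F) p) (BDeRham (integerC F) p) (σ • x) :=
  galBdR_algebraMap σ x

end Ainf

end Literature.NumberTheory.PAdicHodge

end
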